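import Summits.MatrixMultiplication.MatrixMultiplication.Theses.TetrahedronCarving
import Summits.MatrixMultiplication.MatrixMultiplication.Theorems.SesquiTensor
import HarnessLib

/-!
# TetrahedronCarvingSesquiComparison — the three comparison maps of the sesqui-weighted member as items

(decomp-mm cell, route-writer bookkeeping for the BANKED node `SesquiCarving` of lens 6, generation 15.)

The u = 3/2 member of the spoke/rim family of exact carvings (carrier: the sesqui-weighted
tetrahedron `S_n = T(K₄)_n ⊠ W_n = T_f(K₄)`, `f = (n³,n³,n³,n²,n²,n²)`, tree
`Theorems.SesquiTensor.sesqui` / `omegaSesqui` =: `Ω`) was banked as five `aside` items on the route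
`TetrahedronCarving` (rev 3). Three of them are comparison maps along the family and are tree theorems
already (`Theorems/SesquiTensor.lean`); this file closes them BY NAME:

* `sesquiNoSavingOfTetraNoSaving_holds : SesquiNoSavingOfTetraNoSaving` — item
  `stmt-MatrixMultiplication-27191`: the residual weakens along `u = 1 → 3/2`,
  `TetraNoSaving → 5ω ≤ Ω`, from the rim cover `3·ω(K₄) ≤ ω + Ω`
  (`Theorems.SesquiTensor.sesquiNoSaving_of_tetraNoSaving`).
* `coneNoSavingOfSesquiNoSaving_holds : ConeNoSavingOfSesquiNoSaving` — item
  `stmt-MatrixMultiplication-27192`: the residual weakens along `u = 3/2 → 2`,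
  `5ω ≤ Ω → 3ω ≤ ω(W)`, from the Kronecker cover `Ω ≤ ω(K₄) + ω(W)`
  (`Theorems.SesquiTensor.coneNoSaving_of_sesquiNoSaving`).
* `sesquiFlatOfConeFlat_holds : SesquiFlatOfConeFlat` — item `stmt-MatrixMultiplication-27193`: the
  attacked piece strengthens along `u = 2 → 3/2`, `ω(W) ≤ 6 → Ω ≤ 10`
  (`Theorems.SesquiTensor.omegaSesqui_le_ten_of_omegaCone_le_six`).

References: [cite: ChristandlVranaZuiddam2016, §2.1, Prop. 2.1.7]; arXiv:1609.07476 §2.1.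
-/

set_option linter.dupNamespace false -- `MatrixMultiplication.MatrixMultiplication` (summit = problem, D-0017)

noncomputable section

open Summit.MatrixMultiplication.MatrixMultiplication.Theses.TetrahedronCarving

namespace Summit.MatrixMultiplication.MatrixMultiplication.Theorems.TetrahedronCarvingSesquiComparison

/-- **Item `stmt-MatrixMultiplication-27191` (`SesquiNoSavingOfTetraNoSaving`)**: the u = 1 residual implies
the u = 3/2 residual, `2ω ≤ ω(K₄) → 5ω ≤ Ω`. [cite: ChristandlVranaZuiddam2016, §2.1] -/
theorem sesquiNoSavingOfTetraNoSaving_holds : SesquiNoSavingOfTetraNoSaving := fun h =>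
  Summit.MatrixMultiplication.MatrixMultiplication.Theorems.SesquiTensor.sesquiNoSaving_of_tetraNoSaving ℂ h

/-- **Item `stmt-MatrixMultiplication-27192` (`ConeNoSavingOfSesquiNoSaving`)**: the u = 3/2 residual implies
the u = 2 residual, `5ω ≤ Ω → 3ω ≤ ω(W)`. [cite: ChristandlVranaZuiddam2016, §2.1] -/
theorem coneNoSavingOfSesquiNoSaving_holds : ConeNoSavingOfSesquiNoSaving := fun h =>
  Summit.MatrixMultiplication.MatrixMultiplication.Theorems.SesquiTensor.coneNoSaving_of_sesquiNoSaving ℂ h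

/-- **Item `stmt-MatrixMultiplication-27193` (`SesquiFlatOfConeFlat`)**: the u = 2 attacked piece implies
the u = 3/2 attacked piece, `ω(W) ≤ 6 → Ω ≤ 10`. [cite: ChristandlVranaZuiddam2016, Prop. 2.1.7] -/
theorem sesquiFlatOfConeFlat_holds : SesquiFlatOfConeFlat := fun h =>
  Summit.MatrixMultiplication.MatrixMultiplication.Theorems.SesquiTensor.omegaSesqui_le_ten_of_omegaCone_le_six ℂ h

end Summit.MatrixMultiplication.MatrixMultiplication.Theorems.TetrahedronCarvingSesquiComparison

end
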